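import Literature.Topology.FourManifolds.RouteMonotone
import HarnessLib

/-!
# The fingertip is a graph over the twisted height (signed twist)

Topic `Literature/Topology/FourManifolds`; fact seat `provefact-IsStrictHandleSlide.isSurgery`
(R. C. Kirby, *The Topology of 4-Manifolds*, LNM 1374 (1989), Ch. I §4, Fig. 4.2; remaining content:
the named fact (S) `Literature.Topology.FourManifolds.FramedLink.IsStrictHandleSlide.slideModel`).
Companion of `RouteMonotone.lean` (route from the tip to the landing) for the other curve of the
sweep: one half of the fingertip of the finger knot `K₁`, read in the slice as a curve over the
height `h ∈ [h_D, h_A]` from the tip (`h_D`: radius `r_D`, angle `θ_D`, twisted to the vertical: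
`e^{c r_D} tan (θ_D/2) = 1`) to the axis (`h_A`: angle `0`), with angle strictly decreasing,
radius non-increasing, and **decreasing at a definite rate `λ` on an initial zone `[h_D, h_g]`**.
For a twist `c` of either sign its twisted height `y = r sin (twistAngle c r θ)` is strictly
decreasing (`strictAntiOn_fingerY_signed`): on the initial zone by the near-vertical criterion
(`|cos α| ≤ s`, `RouteMonotone.lean`), beyond it because the twist angle has dropped below the
vertical (`α ≤ π/2 + |c| (r_D - r) - q₋ m_Θ (h - h_D)`) so that `cos α > 0` and the fingertip
criterion of `FingerGraph.lean` applies.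

* `FingerHyp` (structure: the curve, its bounds and the three conditions), `FingerHyp.strictAntiOn_y`.

## References

* R. C. Kirby, *The Topology of 4-Manifolds*, LNM 1374, Springer (1989), Ch. I §4. [Kirby1989]
-/

open scoped Topology
open Set Real Filter

noncomputable section

namespace Literature.Topology.FourManifolds

/-- **Fingertip criterion, signed twist.** With `cos α > 0`, `sin α ≥ 0`, `-Λ ≤ ṙ ≤ 0`,
`θ̇ ≤ -m_Θ < 0`, `q ≥ q₋ > 0` and `Λ |c| < q₋ m_Θ`: `ẏ < 0`. (If `1 + R c cos α ≥ 0` the radial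
term has the right sign; otherwise `c < 0` and it is at most `Λ R |c| cos α`, beaten by the angular
term `-R cos α q₋ m_Θ`.) [folklore] -/
theorem curveY_deriv_neg_of_finger_abs {c R r' θ' α q Lam qmin mΘ : ℝ} (hR : 0 < R) (hq : qmin ≤ q)
    (hqmin : 0 < qmin) (hθ : θ' ≤ -mΘ) (hm : 0 < mΘ) (hcos : 0 < cos α) (hsin : 0 ≤ sin α)
    (hr0 : r' ≤ 0) (hrl : -Lam ≤ r') (hlam : Lam * |c| < qmin * mΘ) :
    r' * sin α + R * (cos α * (c * sin α * r' + q * θ')) < 0 := by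
  rw [curveY_deriv_eq]
  have hRc : 0 < R * cos α := mul_pos hR hcos
  have hqθ : q * θ' ≤ -(qmin * mΘ) := by
    have hθ0 : θ' ≤ 0 := by linarith
    nlinarith [mul_le_mul_of_nonpos_right hq hθ0]
  have h2 : R * cos α * q * θ' ≤ -(R * cos α * (qmin * mΘ)) := by
    have := mul_le_mul_of_nonneg_left hqθ hRc.le; linarith [this]
  by_cases hb : 0 ≤ 1 + R * c * cos α
  · have h1 : r' * sin α * (1 + R * c * cos α) ≤ 0 :=
      mul_nonpos_of_nonpos_of_nonneg (mul_nonpos_of_nonpos_of_nonneg hr0 hsin) hb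
    nlinarith [mul_pos hRc (mul_pos hqmin hm)]
  · have hb' : 1 + R * c * cos α < 0 := lt_of_not_ge hb
    -- `-(1 + R c cos α) ≤ R |c| cos α`
    have hneg : -(1 + R * c * cos α) ≤ R * |c| * cos α := by
      have : -(R * c * cos α) ≤ |R * c * cos α| := neg_le_abs _
      rw [abs_mul, abs_mul, abs_of_pos hR, abs_of_pos hcos] at this
      linarith
    have hsin1 : sin α ≤ 1 := sin_le_one α
    -- `term1 = (-r') sin α (-(1 + R c cos α)) ≤ Λ · 1 · R |c| cos α`
    have h1 : r' * sin α * (1 + R * c * cos α) ≤ Lam * (R * |c| * cos α) := by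
      have e : r' * sin α * (1 + R * c * cos α) = (-r') * sin α * (-(1 + R * c * cos α)) := by ring
      rw [e]
      have ha : (-r') * sin α ≤ Lam := by nlinarith
      have hb0 : 0 ≤ -(1 + R * c * cos α) := by linarith
      calc (-r') * sin α * (-(1 + R * c * cos α)) ≤ Lam * (-(1 + R * c * cos α)) :=
            mul_le_mul_of_nonneg_right ha hb0
        _ ≤ Lam * (R * |c| * cos α) := mul_le_mul_of_nonneg_left hneg (by nlinarith)
    have h3 : Lam * (R * |c| * cos α) - R * cos α * (qmin * mΘ) = R * cos α * (Lam * |c| - qmin * mΘ) := by ring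
    nlinarith [mul_neg_of_pos_of_neg hRc (sub_neg.2 hlam)]

/-- **Hypotheses for the monotonicity of a fingertip half** (see the module docstring).
[cite: Kirby1989, Ch. I §4] -/
structure FingerHyp where
  c : ℝ
  hD : ℝ
  hg : ℝ
  hA : ℝ
  r : ℝ → ℝ
  θ : ℝ → ℝ
  dr : ℝ → ℝ
  dθ : ℝ → ℝ
  rD : ℝ
  lam : ℝ
  mΘ : ℝ
  MΘ : ℝ
  hDg : hD < hg
  hgA : hg ≤ hA
  hasDeriv_r : ∀ h ∈ Icc hD hA, HasDerivAt r (dr h) h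
  hasDeriv_θ : ∀ h ∈ Icc hD hA, HasDerivAt θ (dθ h) h
  /-- The angle runs in `[0, θ_D]`, `θ_D = θ h_D < π`, and is positive before the axis. -/
  θ_mem : ∀ h ∈ Icc hD hA, θ h ∈ Icc 0 (θ hD)
  θ_pos : ∀ h ∈ Ico hD hA, 0 < θ h
  θD_lt : θ hD < π
  r_mem : ∀ h ∈ Icc hD hA, r h ∈ Icc 1 rD
  rD_le : rD ≤ 2
  r_hD : r hD = rD
  dr_nonpos : ∀ h ∈ Icc hD hA, dr h ≤ 0
  lam_pos : 0 < lam
  dr_le : ∀ h ∈ Icc hD hg, dr h ≤ -lam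
  Lam : ℝ
  dr_ge : ∀ h ∈ Icc hg hA, -Lam ≤ dr h
  mΘ_pos : 0 < mΘ
  dθ_mem : ∀ h ∈ Icc hD hA, -MΘ ≤ dθ h ∧ dθ h ≤ -mΘ
  /-- **Tip condition.** -/
  tip : exp (c * rD) * tan (θ hD / 2) = 1
  /-- COND-F1: the band is thin, `s = |c| (r_D - 1) + q₊ MΘ (h_g - h_D) ≤ min (1/2, 1/(16|c|))`. -/
  condF1 : |c| * (rD - 1) + exp (|c| * 2) / cos (θ hD / 2) ^ 2 * MΘ * (hg - hD) ≤ 2⁻¹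
  condF1' : 8 * |c| * (|c| * (rD - 1) + exp (|c| * 2) / cos (θ hD / 2) ^ 2 * MΘ * (hg - hD)) ≤ 1
  /-- COND-F2: the mixed term is small against the radial speed on the initial zone. -/
  condF2 : 16 * (exp (|c| * 2) / cos (θ hD / 2) ^ 2 * MΘ) *
    (|c| * (rD - 1) + exp (|c| * 2) / cos (θ hD / 2) ^ 2 * MΘ * (hg - hD)) < lam
  /-- COND-F3: by the end of the initial zone the twist angle is below the vertical. -/
  condF3 : |c| * (rD - 1) < exp (-(|c| * 2)) * mΘ * (hg - hD)
  /-- COND-F4: beyond the initial zone the descent is gentle: `Λ |c| < q₋ m_Θ`. -/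
  condF4 : Lam * |c| < exp (-(|c| * 2)) * mΘ

namespace FingerHyp

variable (F : FingerHyp)

/-- The upper bound of `twistQ` on the fingertip. [folklore] -/
def qmax : ℝ := exp (|F.c| * 2) / cos (F.θ F.hD / 2) ^ 2

/-- The lower bound of `twistQ` on the fingertip. [folklore] -/
def qmin : ℝ := exp (-(|F.c| * 2))

/-- The half-width of the twist-angle band on the initial zone. [folklore] -/
def s : ℝ := |F.c| * (F.rD - 1) + F.qmax * F.MΘ * (F.hg - F.hD)

/-- The twist angle along the fingertip. [folklore] -/
def α (h : ℝ) : ℝ := twistAngle F.c (F.r h) (F.θ h)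

/-- **The twisted height along the fingertip.** [folklore] -/
def y (h : ℝ) : ℝ := F.r h * sin (F.α h)

/-- `hD_le_hA` (auxiliary). [folklore] -/
theorem hD_le_hA : F.hD ≤ F.hA := F.hDg.le.trans F.hgA

/-- `θD_pos` (auxiliary). [folklore] -/
theorem θD_pos : 0 < F.θ F.hD := F.θ_pos _ ⟨le_rfl, F.hDg.trans_le F.hgA⟩

/-- `MΘ_pos` (auxiliary). [folklore] -/
theorem MΘ_pos : 0 < F.MΘ := by
  have h := F.dθ_mem F.hD ⟨le_rfl, F.hD_le_hA⟩; linarith [F.mΘ_pos, h.1, h.2]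

/-- `one_le_rD` (auxiliary). [folklore] -/
theorem one_le_rD : 1 ≤ F.rD := by
  have := F.r_mem F.hD ⟨le_rfl, F.hD_le_hA⟩; rw [F.r_hD] at this; exact this.1

/-- `cos_half_pos` (auxiliary). [folklore] -/
theorem cos_half_pos : 0 < cos (F.θ F.hD / 2) := by
  have h1 := F.θD_lt; have h2 := F.θD_pos
  exact cos_pos_of_mem_Ioo ⟨by linarith [pi_pos], by linarith⟩

/-- `qmax_pos` (auxiliary). [folklore] -/
theorem qmax_pos : 0 < F.qmax := div_pos (exp_pos _) (pow_pos F.cos_half_pos 2)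
/-- `qmin_pos` (auxiliary). [folklore] -/
theorem qmin_pos : 0 < F.qmin := exp_pos _

/-- `s_nonneg` (auxiliary). [folklore] -/
theorem s_nonneg : 0 ≤ F.s := by
  rw [s]
  exact add_nonneg (mul_nonneg (abs_nonneg _) (by linarith [F.one_le_rD]))
    (mul_nonneg (mul_nonneg F.qmax_pos.le F.MΘ_pos.le) (by linarith [F.hDg]))

/-- `s_le_half` (auxiliary). [folklore] -/
theorem s_le_half : F.s ≤ 2⁻¹ := F.condF1
/-- `cs_le` (auxiliary). [folklore] -/
theorem cs_le : 8 * |F.c| * F.s ≤ 1 := F.condF1'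
/-- `Ks_lt` (auxiliary). [folklore] -/
theorem Ks_lt : 16 * (F.qmax * F.MΘ) * F.s < F.lam := F.condF2
/-- `drop_lt` (auxiliary). [folklore] -/
theorem drop_lt : |F.c| * (F.rD - 1) < F.qmin * F.mΘ * (F.hg - F.hD) := F.condF3

/-! ### Pointwise facts along the fingertip -/

/-- `θ_mem_Ioo` (auxiliary). [folklore] -/
theorem θ_mem_Ioo {h : ℝ} (hh : h ∈ Icc F.hD F.hA) : F.θ h ∈ Ioo (-π) π :=
  ⟨by linarith [(F.θ_mem h hh).1, pi_pos], (F.θ_mem h hh).2.trans_lt F.θD_lt⟩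

/-- `r_pos` (auxiliary). [folklore] -/
theorem r_pos {h : ℝ} (hh : h ∈ Icc F.hD F.hA) : 0 < F.r h := by linarith [(F.r_mem h hh).1]

/-- `r_le_two` (auxiliary). [folklore] -/
theorem r_le_two {h : ℝ} (hh : h ∈ Icc F.hD F.hA) : F.r h ≤ 2 := (F.r_mem h hh).2.trans F.rD_le

/-- The bounds of `twistQ` on the fingertip. [folklore] -/
theorem twistQ_mem {h : ℝ} (hh : h ∈ Icc F.hD F.hA) :
    F.qmin ≤ twistQ F.c (F.r h) (F.θ h) ∧ twistQ F.c (F.r h) (F.θ h) ≤ F.qmax := by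
  have hr := F.r_mem h hh; have hr2 := F.r_le_two hh; have hθ := F.θ_mem h hh
  have hθ' := F.θ_mem_Ioo hh
  set E := exp (F.c * F.r h) with hE
  have hEp : 0 < E := exp_pos _
  have hcr : |F.c * F.r h| ≤ |F.c| * 2 := by
    rw [abs_mul, abs_of_nonneg (by linarith [hr.1] : 0 ≤ F.r h)]
    exact mul_le_mul_of_nonneg_left hr2 (abs_nonneg _)
  have hEle : E ≤ exp (|F.c| * 2) := exp_le_exp.2 ((le_abs_self _).trans hcr)
  have hEge : exp (-(|F.c| * 2)) ≤ E := exp_le_exp.2 (by have := (abs_le.1 hcr).1; linarith)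
  have hc0 : 0 < cos (F.θ h / 2) := cos_pos_of_mem_Ioo ⟨by linarith [hθ'.1], by linarith [hθ'.2]⟩
  have hcos : cos (F.θ F.hD / 2) ≤ cos (F.θ h / 2) := by
    apply cos_le_cos_of_nonneg_of_le_pi
    · linarith [hθ.1]
    · linarith [F.θD_lt, pi_pos]
    · linarith [hθ.2]
  have hcs : cos (F.θ h / 2) ^ 2 + sin (F.θ h / 2) ^ 2 = 1 := cos_sq_add_sin_sq _
  have hden_pos : 0 < cos (F.θ h / 2) ^ 2 + E ^ 2 * sin (F.θ h / 2) ^ 2 := by positivity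
  rw [twistQ, ← hE]
  constructor
  · rw [qmin]
    rcases le_or_gt 1 E with hE1 | hE1
    · have hden_le : cos (F.θ h / 2) ^ 2 + E ^ 2 * sin (F.θ h / 2) ^ 2 ≤ E ^ 2 := by
        have hE2 : 1 ≤ E ^ 2 := by nlinarith
        nlinarith [mul_nonneg (sub_nonneg.2 hE2) (sq_nonneg (cos (F.θ h / 2)))]
      calc exp (-(|F.c| * 2)) ≤ E⁻¹ := by
            rw [hE, ← exp_neg]; exact exp_le_exp.2 (by have := (abs_le.1 hcr).2; linarith)
        _ = E / E ^ 2 := by field_simp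
        _ ≤ E / (cos (F.θ h / 2) ^ 2 + E ^ 2 * sin (F.θ h / 2) ^ 2) :=
            div_le_div_of_nonneg_left hEp.le hden_pos hden_le
    · have hden_le : cos (F.θ h / 2) ^ 2 + E ^ 2 * sin (F.θ h / 2) ^ 2 ≤ 1 := by
        have hE2 : E ^ 2 ≤ 1 := by nlinarith
        nlinarith [mul_nonneg (sub_nonneg.2 hE2) (sq_nonneg (sin (F.θ h / 2)))]
      calc exp (-(|F.c| * 2)) ≤ E := hEge
        _ = E / 1 := (div_one E).symm
        _ ≤ E / (cos (F.θ h / 2) ^ 2 + E ^ 2 * sin (F.θ h / 2) ^ 2) :=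
            div_le_div_of_nonneg_left hEp.le hden_pos hden_le
  · rw [qmax]
    have hc2 : 0 < cos (F.θ F.hD / 2) ^ 2 := pow_pos F.cos_half_pos 2
    calc E / (cos (F.θ h / 2) ^ 2 + E ^ 2 * sin (F.θ h / 2) ^ 2) ≤ E / cos (F.θ F.hD / 2) ^ 2 := by
          apply div_le_div_of_nonneg_left hEp.le hc2
          nlinarith [mul_nonneg (sq_nonneg E) (sq_nonneg (sin (F.θ h / 2))),
            mul_self_le_mul_self F.cos_half_pos.le hcos]
      _ ≤ exp (|F.c| * 2) / cos (F.θ F.hD / 2) ^ 2 := div_le_div_of_nonneg_right hEle hc2.le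

/-- The mixed term is bounded on the fingertip: `|twistQ · θ̇| ≤ q₊ MΘ`. [folklore] -/
theorem abs_q_dθ_le {h : ℝ} (hh : h ∈ Icc F.hD F.hA) : |twistQ F.c (F.r h) (F.θ h) * F.dθ h| ≤ F.qmax * F.MΘ := by
  have hq := F.twistQ_mem hh
  have hq0 : 0 ≤ twistQ F.c (F.r h) (F.θ h) := F.qmin_pos.le.trans hq.1
  have hΘ := F.dθ_mem h hh
  have hΘabs : |F.dθ h| ≤ F.MΘ := abs_le.2 ⟨hΘ.1, by linarith [F.mΘ_pos]⟩
  rw [abs_mul, abs_of_nonneg hq0]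
  exact mul_le_mul hq.2 hΘabs (abs_nonneg _) F.qmax_pos.le

/-- **At the tip the twist angle is `π/2`.** [folklore] -/
theorem α_hD : F.α F.hD = π / 2 := by
  rw [α, twistAngle, F.r_hD, F.tip, arctan_one]; ring

/-! ### The twist angle along the fingertip -/

/-- **Upper bound**: `α h ≤ π/2 + |c| (r_D - r h) - q₋ m_Θ (h - h_D)`. [folklore] -/
theorem α_le {h : ℝ} (hh : h ∈ Icc F.hD F.hA) :
    F.α h ≤ π / 2 + |F.c| * (F.rD - F.r h) - F.qmin * F.mΘ * (h - F.hD) := by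
  have hI : ∀ u ∈ Icc F.hD h, u ∈ Icc F.hD F.hA := fun u hu ↦ ⟨hu.1, hu.2.trans hh.2⟩
  -- `ψ = α + |c| r + q₋ mΘ · id` is non-increasing on `[h_D, h]`
  set ψ : ℝ → ℝ := fun u ↦ twistAngle F.c (F.r u) (F.θ u) + |F.c| * F.r u + F.qmin * F.mΘ * u with hψ
  have hψd : ∀ u ∈ Icc F.hD h, HasDerivAt ψ
      ((F.c * sin (twistAngle F.c (F.r u) (F.θ u)) * F.dr u + twistQ F.c (F.r u) (F.θ u) * F.dθ u) +
        |F.c| * F.dr u + F.qmin * F.mΘ * 1) u := fun u hu ↦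
    ((hasDerivAt_twistAngle_curve F.c (F.hasDeriv_r u (hI u hu)) (F.hasDeriv_θ u (hI u hu)) (F.θ_mem_Ioo (hI u hu))).add
      ((F.hasDeriv_r u (hI u hu)).const_mul |F.c|)).add ((hasDerivAt_id u).const_mul _)
  have hanti : AntitoneOn ψ (Icc F.hD h) := by
    refine antitoneOn_of_deriv_nonpos (convex_Icc _ _) ?_ ?_ ?_
    · exact fun u hu ↦ (hψd u hu).continuousAt.continuousWithinAt
    · intro u hu
      rw [interior_Icc] at hu
      exact (hψd u (Ioo_subset_Icc_self hu)).differentiableAt.differentiableWithinAt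
    · intro u hu
      rw [interior_Icc] at hu
      have hu' := Ioo_subset_Icc_self hu
      rw [(hψd u hu').deriv]
      have h1 := c_sin_mul_le (c := F.c) (α := twistAngle F.c (F.r u) (F.θ u)) (F.dr_nonpos u (hI u hu'))
      have hq := (F.twistQ_mem (hI u hu')).1
      have hθ' := (F.dθ_mem u (hI u hu')).2
      -- `q dθ ≤ q₋ dθ ≤ -q₋ mΘ`
      have h2 : twistQ F.c (F.r u) (F.θ u) * F.dθ u ≤ -(F.qmin * F.mΘ) := by
        have hdθ : F.dθ u ≤ 0 := by linarith [F.mΘ_pos]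
        nlinarith [mul_le_mul_of_nonpos_right hq hdθ, F.qmin_pos]
      linarith
  have := hanti ⟨le_rfl, hh.1⟩ ⟨hh.1, le_rfl⟩ hh.1
  simp only [hψ] at this
  rw [F.r_hD] at this
  have hαD : twistAngle F.c F.rD (F.θ F.hD) = π / 2 := by have := F.α_hD; rwa [α, F.r_hD] at this
  rw [hαD] at this
  rw [α]; linarith

/-- **Lower bound**: `α h ≥ π/2 - |c| (r_D - r h) - q₊ MΘ (h - h_D)`. [folklore] -/
theorem le_α {h : ℝ} (hh : h ∈ Icc F.hD F.hA) :
    π / 2 - |F.c| * (F.rD - F.r h) - F.qmax * F.MΘ * (h - F.hD) ≤ F.α h := by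
  have hI : ∀ u ∈ Icc F.hD h, u ∈ Icc F.hD F.hA := fun u hu ↦ ⟨hu.1, hu.2.trans hh.2⟩
  have hge := twistAngle_curve_ge_lip_abs (c := F.c) (r := F.r) (θ := F.θ) (dr := F.dr) (dθ := F.dθ)
    (t₁ := F.hD) (t₂ := h) hh.1 (fun u hu ↦ F.hasDeriv_r u (hI u hu)) (fun u hu ↦ F.hasDeriv_θ u (hI u hu))
    (fun u hu ↦ F.θ_mem_Ioo (hI u hu)) (fun u hu ↦ F.dr_nonpos u (hI u hu))
    (K := F.qmax * F.MΘ) (fun u hu ↦ (abs_le.1 (F.abs_q_dθ_le (hI u hu))).1) (t := h) ⟨hh.1, le_rfl⟩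
  have hαD : twistAngle F.c (F.r F.hD) (F.θ F.hD) = π / 2 := F.α_hD
  rw [hαD, F.r_hD] at hge
  rw [α]; linarith

/-- On the initial zone the twist angle stays within `s` of the vertical. [folklore] -/
theorem abs_α_sub_le {h : ℝ} (hh : h ∈ Icc F.hD F.hg) : |F.α h - π / 2| ≤ F.s := by
  have hh' : h ∈ Icc F.hD F.hA := ⟨hh.1, hh.2.trans F.hgA⟩
  have h1 := F.α_le hh'; have h2 := F.le_α hh'
  have hr := F.r_mem h hh'
  have hdrop : |F.c| * (F.rD - F.r h) ≤ |F.c| * (F.rD - 1) := mul_le_mul_of_nonneg_left (by linarith [hr.1]) (abs_nonneg _)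
  have hKt : F.qmax * F.MΘ * (h - F.hD) ≤ F.qmax * F.MΘ * (F.hg - F.hD) :=
    mul_le_mul_of_nonneg_left (by linarith [hh.2]) (mul_nonneg F.qmax_pos.le F.MΘ_pos.le)
  have hqm : 0 ≤ F.qmin * F.mΘ * (h - F.hD) := mul_nonneg (mul_nonneg F.qmin_pos.le F.mΘ_pos.le) (by linarith [hh.1])
  have h0 : 0 ≤ |F.c| * (F.rD - F.r h) := mul_nonneg (abs_nonneg _) (by linarith [hr.2])
  have h0' : 0 ≤ F.qmax * F.MΘ * (F.hg - F.hD) :=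
    mul_nonneg (mul_nonneg F.qmax_pos.le F.MΘ_pos.le) (by linarith [F.hDg])
  rw [abs_le, s]
  constructor <;> linarith

/-- `abs_cos_α_le` (auxiliary). [folklore] -/
theorem abs_cos_α_le {h : ℝ} (hh : h ∈ Icc F.hD F.hg) : |cos (F.α h)| ≤ F.s := by
  have e : cos (F.α h) = sin (π / 2 - F.α h) := by rw [sin_pi_div_two_sub]
  rw [e]
  refine (Real.abs_sin_le_abs).trans ?_
  rw [abs_sub_comm]; exact F.abs_α_sub_le hh

/-- `half_le_sin_α` (auxiliary). [folklore] -/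
theorem half_le_sin_α {h : ℝ} (hh : h ∈ Icc F.hD F.hg) : 1 / 2 ≤ sin (F.α h) := by
  have e : sin (F.α h) = cos (F.α h - π / 2) := by rw [← cos_sub_pi_div_two]
  rw [e]
  have hb := F.abs_α_sub_le hh
  have hs := F.s_le_half
  have hc := Real.one_sub_sq_div_two_le_cos (x := F.α h - π / 2)
  have hsq : (F.α h - π / 2) ^ 2 ≤ (1 / 2) ^ 2 := by
    have := abs_le.1 hb
    nlinarith [this.1, this.2, F.s_nonneg]
  nlinarith

/-- **Beyond the initial zone the twist angle is strictly below the vertical.** [folklore] -/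
theorem α_lt_of_hg_le {h : ℝ} (hh : h ∈ Icc F.hg F.hA) : F.α h < π / 2 := by
  have hh' : h ∈ Icc F.hD F.hA := ⟨F.hDg.le.trans hh.1, hh.2⟩
  have h1 := F.α_le hh'
  have hr := F.r_mem h hh'
  have hdrop : |F.c| * (F.rD - F.r h) ≤ |F.c| * (F.rD - 1) := mul_le_mul_of_nonneg_left (by linarith [hr.1]) (abs_nonneg _)
  have hqm : F.qmin * F.mΘ * (F.hg - F.hD) ≤ F.qmin * F.mΘ * (h - F.hD) :=
    mul_le_mul_of_nonneg_left (by linarith [hh.1]) (mul_nonneg F.qmin_pos.le F.mΘ_pos.le)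
  have := F.drop_lt
  linarith

/-- The twist angle is non-negative (the angle is). [folklore] -/
theorem α_nonneg {h : ℝ} (hh : h ∈ Icc F.hD F.hA) : 0 ≤ F.α h := by
  rw [α]
  rcases (F.θ_mem h hh).1.eq_or_lt with h0 | h0
  · rw [← h0, twistAngle_zero]
  · exact (twistAngle_pos F.c (F.r h) ⟨h0, (F.θ_mem_Ioo hh).2⟩).le

/-- `cos_α_pos_of_hg_le` (auxiliary). [folklore] -/
theorem cos_α_pos_of_hg_le {h : ℝ} (hh : h ∈ Icc F.hg F.hA) : 0 < cos (F.α h) :=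
  cos_pos_of_mem_Ioo ⟨by linarith [F.α_nonneg ⟨F.hDg.le.trans hh.1, hh.2⟩, pi_pos], F.α_lt_of_hg_le hh⟩

/-! ### The derivative of the twisted height -/

/-- `hasDerivAt_y` (auxiliary). [folklore] -/
theorem hasDerivAt_y {h : ℝ} (hh : h ∈ Icc F.hD F.hA) :
    HasDerivAt F.y (F.dr h * sin (F.α h) +
      F.r h * (cos (F.α h) * (F.c * sin (F.α h) * F.dr h + twistQ F.c (F.r h) (F.θ h) * F.dθ h))) h :=
  hasDerivAt_curveY F.c (F.hasDeriv_r h hh) (F.hasDeriv_θ h hh) (F.θ_mem_Ioo hh)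

/-- **On the initial zone `ẏ < 0`** (near-vertical criterion, signed twist). [folklore] -/
theorem deriv_y_neg_of_le_hg {h : ℝ} (hh : h ∈ Icc F.hD F.hA) (hg : h ≤ F.hg) : deriv F.y h < 0 := by
  rw [(F.hasDerivAt_y hh).deriv]
  have hzone : h ∈ Icc F.hD F.hg := ⟨hh.1, hg⟩
  have hr' := F.dr_le h hzone
  have hq := F.twistQ_mem hh
  have hsin := F.half_le_sin_α hzone
  refine curveY_deriv_neg_of_nearVertical_abs (F.r_pos hh) (by linarith [F.lam_pos]) (by linarith)
    (F.qmin_pos.le.trans hq.1) (F.abs_cos_α_le hzone) ?_ ?_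
  · have := F.cs_le; have hr := F.r_le_two hh
    nlinarith [mul_nonneg (abs_nonneg F.c) F.s_nonneg, F.r_pos hh]
  · have hK := F.abs_q_dθ_le hh
    have hq0 : 0 ≤ twistQ F.c (F.r h) (F.θ h) := F.qmin_pos.le.trans hq.1
    have hqθ : twistQ F.c (F.r h) (F.θ h) * |F.dθ h| ≤ F.qmax * F.MΘ := by rwa [abs_mul, abs_of_nonneg hq0] at hK
    have hr := F.r_le_two hh; have hr0 := F.r_pos hh
    have hKs := F.Ks_lt
    have h1 : F.r h * twistQ F.c (F.r h) (F.θ h) * |F.dθ h| * F.s ≤ 2 * (F.qmax * F.MΘ) * F.s := by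
      have : F.r h * (twistQ F.c (F.r h) (F.θ h) * |F.dθ h|) ≤ 2 * (F.qmax * F.MΘ) :=
        mul_le_mul hr hqθ (mul_nonneg hq0 (abs_nonneg _)) (by norm_num)
      have := mul_le_mul_of_nonneg_right this F.s_nonneg
      linarith
    have h2 : F.lam / 4 ≤ -F.dr h * sin (F.α h) / 2 := by
      have : F.lam * (1 / 2) ≤ -F.dr h * sin (F.α h) := mul_le_mul (by linarith) hsin (by norm_num) (by linarith [F.lam_pos])
      linarith
    have hKs0 : 0 ≤ F.qmax * F.MΘ * F.s := mul_nonneg (mul_nonneg F.qmax_pos.le F.MΘ_pos.le) F.s_nonneg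
    linarith [F.lam_pos]

/-- **Beyond the initial zone `ẏ < 0`** (fingertip criterion, signed twist). [folklore] -/
theorem deriv_y_neg_of_hg_le {h : ℝ} (hh : h ∈ Icc F.hD F.hA) (hg : F.hg ≤ h) : deriv F.y h < 0 := by
  rw [(F.hasDerivAt_y hh).deriv]
  have hq := F.twistQ_mem hh
  have hsin : 0 ≤ sin (F.α h) := sin_nonneg_of_nonneg_of_le_pi (F.α_nonneg hh)
    (by rw [α]; exact (twistAngle_mem_Ioo _ _ _).2.le)
  exact curveY_deriv_neg_of_finger_abs (F.r_pos hh) hq.1 F.qmin_pos (F.dθ_mem h hh).2 F.mΘ_pos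
    (F.cos_α_pos_of_hg_le ⟨hg, hh.2⟩) hsin (F.dr_nonpos h hh) (F.dr_ge h ⟨hg, hh.2⟩) F.condF4

/-- **`ẏ < 0` on the whole fingertip half.** [folklore] -/
theorem deriv_y_neg {h : ℝ} (hh : h ∈ Icc F.hD F.hA) : deriv F.y h < 0 := by
  rcases le_or_gt h F.hg with h1 | h1
  · exact F.deriv_y_neg_of_le_hg hh h1
  · exact F.deriv_y_neg_of_hg_le hh h1.le

/-- **The twisted height is strictly decreasing along the fingertip half.**
[cite: Kirby1989, Ch. I §4] -/
theorem strictAntiOn_y : StrictAntiOn F.y (Icc F.hD F.hA) := by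
  refine strictAntiOn_of_deriv_neg (convex_Icc _ _) ?_ ?_
  · exact fun h hh ↦ (F.hasDerivAt_y hh).continuousAt.continuousWithinAt
  · intro h hh
    rw [interior_Icc] at hh
    exact F.deriv_y_neg (Ioo_subset_Icc_self hh)

/-- At the tip, `y = r_D`. [folklore] -/
theorem y_hD : F.y F.hD = F.rD := by rw [y, F.α_hD, sin_pi_div_two, mul_one, F.r_hD]

/-- On the fingertip `0 ≤ y ≤ r_D`. [folklore] -/
theorem y_mem {h : ℝ} (hh : h ∈ Icc F.hD F.hA) : F.y h ∈ Icc 0 F.rD := by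
  have hmono := F.strictAntiOn_y.antitoneOn
  refine ⟨?_, ?_⟩
  · rw [y]
    exact mul_nonneg (F.r_pos hh).le (sin_nonneg_of_nonneg_of_le_pi (F.α_nonneg hh)
      (by rw [α]; exact (twistAngle_mem_Ioo _ _ _).2.le))
  · rw [← F.y_hD]; exact hmono ⟨le_rfl, F.hD_le_hA⟩ hh hh.1

end FingerHyp

end Literature.Topology.FourManifolds
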